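import Summits.QuantumFields.YangMills.Theorems.BalabanUVNodesN19AgeScaleTransportBudget
import Literature.MathematicalPhysics.QuantumFieldTheory.Balaban1983to89.T4BadClassBooking

/-!
# BalabanUVNodes ∕ N20 (NE7b) — THE FIRST-LEVEL SATURATION COUNT MADE KERNEL: in `T4BadClassBooking`'s independent-levels product model, with Bałaban's large-field
# activity per finest block and `m^K` blocks (`m = L⁴ ≥ 2`), the youngest large-field class has probability `1 − (1 − a_K)^{m^K} → 1`, is SATURATED at every level
# `c < 1`, and admits NO relative weight bound — the toy inhabitant of the policy wall's displayed antecedent (dag-n20-w3 LOCATED-1 (2) ∕ this seat's `…PolicyWall`)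

Cell `pub-ymgap` (HUMAN RULING D-0062 Track A; work-bound push D-0149, director-ym №197), width seat `pub-ymgap-dag-n20-w1` (gen 4) on node N20 = NE7b; key item K3⁷
`SpineGivenEndpointR13SepCoPH` = stmt-QuantumFields-20544 (`--kind proof --supports 20544 --as helper`); COUNT-NEUTRAL.  Bus: CLAIM-6 ∕ INTENT-10 (INBOX l.28681).
[III] = [Balaban1988Convergent] (CMP 119), [LF-II] = [Balaban1989LargeFieldII] (CMP 122).

WHY.  This seat's g3 POLICY WALL (`…N20KeyedRelWeightPolicyWall`, p597932) types, at dag-n20-d's spine reading of record, the kernel consequence of dag-n20-w3's LOCATED-1 (2)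
COUNT (pub-ymgap INBOX l.24338): «at the (2.18) index of record, with a poly-log suppression `e^{−C·p₀(g₁)²}` per finest block against `≍ L^{4(K₀+K)}` blocks, the class
“a large-field region at the FIRST level” carries asymptotically ALL of a run's mass» — DISPLAYED there as the hypothesis shape `T4BadClassBooking.Saturated` (for Bałaban's dressed
measure the count needs LOWER bounds on large-field weights that neither print nor tree has).  The crux idea card `age-scale-convolution` (ym-nodeO idea-3 g5, evidence n°46∕47
on 20544; CRIT-1 triage n°49) cites that count (its rows 9∕36) as the reason old components must be MATCHED in the core, and dag-n19-w1 g3 LANDED the card's P1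
(`…N19AgeScaleTransportBudget`, p603780) with the activity `a n = exp(−(A·log(x₀ + b·n))^{2p₀})` ([III] (1.1) p.244 ∕ p.246, LOCATION only) proved summable with every moment and
NOT geometric (`eventually_lt_balabanActivity`).  THIS FILE closes the loop at the TOY level: in `T4BadClassBooking` §4's independent-levels product model (`Sanity.T ∕ A ∕ Bad`:
histories = sets of levels carrying a large-field event, per-level probabilities `q`, the young class = «an event at the final level», `Σ_T A = 1`, `Σ_Bad A = q K` EXACTLY), take the
final level to be the FIRST RG level of a `K`-step run — `m^K` finest blocks (`m = L⁴ ≥ 2`, unit physical volume), each large-field INDEPENDENTLY with probability the age-`K`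
activity `a K` — so that `q K := 1 − (1 − a K)^{m^K}`.  Then `m^K · a K → ∞` (NotGeometric at `θ = 1∕m`), `(1 − a K)^{m^K} ≤ exp(−m^K·a K) → 0`, `q K → 1`, the class is
`Saturated` at EVERY `c < 1`, and by `T4BadClassBooking.not_relWeightBound_of_saturated` it admits NO `RelWeightBound`, for NO weight sequence and WHATEVER the second run:
ENTROPY BEATS THE POLY-LOG ACTIVITY — the count, kernel-certified where it can be (a product model), in print's own letters.
* §1 [folklore] `tendsto_one_sub_pow_zero` (`N_K·a_K → ∞`, `a_K ≤ 1` ⇒ `(1 − a_K)^{N_K} → 0`, squeeze under `(1 − a)^N ≤ e^{−Na}`) ·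
  ★ `tendsto_pow_mul_ageActivity_atTop` (`2 ≤ m` ⇒ `m^K · a K → +∞`, dag-n19-w1's `eventually_lt_balabanActivity` BY NAME at `θ = 1∕m`).
* §2 [folklore] IN THE PRODUCT MODEL, GENERAL PROBABILITIES: `saturated_toy_of_eventually_le` (`∀ᶠ K, c ≤ q K`, `0 ≤ l₀` ⇒ `Saturated l₀ T (A q) Bad c`) · ★ `saturated_toy_of_tendsto_one`
  (`q K → 1` ⇒ saturated at every `c < 1`) · `not_relWeightBound_toy_of_tendsto_one` (⇒ no `RelWeightBound`, any `W`, any second-run family `B`) · GENERAL BLOCK COUNTS: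
  `tendsto_blockEventProb_one_of_blocks` ∕ ★ `not_relWeightBound_toy_of_blocks` (`N_K` blocks at probability `a_K ≤ 1`, `N_K·a_K → ∞` ⇒ unbookable).
* §3 THE BAŁABAN-LETTERS INSTANCE: `blockEventProb_nonneg ∕ _le_one` · ★★ `tendsto_blockEventProb_one` · ★★ `saturated_firstLevel_toy_ageActivity` ·
  ★★ `not_relWeightBound_firstLevel_toy_ageActivity`; and the CONTRAST already in the tree: with a SUMMABLE per-level probability the same class IS booked
  (`T4BadClassBooking.Sanity.relWeightBound_of_summable`) — the activity ALONE (one block per level, `m = 1`) is summable (dag-n19-w1's `summable_succ_pow_mul_balabanActivity`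
  at `c = 0`): `relWeightBound_toy_ageActivity_oneBlock`.  The volume factor, not the activity, is the wall.

HONEST FRAMING.  A PRODUCT-MODEL toy (independent levels, independent blocks — `T4BadClassBooking` §4's sanity model, NOT Bałaban's dressed (2.18) measure [III] p.257, whose blocks
and levels are neither independent nor identically weighted); the activity's parameters and `m` are LETTERS (print LOCATED at [III] p.244∕246 by CRIT-1; the volume count is the
number of unit-lattice∕finest blocks, [LF-II] (1.80) p.384 bookkeeping); for Bałaban's runs the saturation of the first-level class remains dag-n20-w3's LOCATED COUNT and the
policy wall's DISPLAYED hypothesis (A6 declared).  Proves NO estimate of the programme; nothing of Bałaban's asserted or instantiated; NE7 ∕ NE7b NOT PRINTED for `d = 4`, NOT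
proved; N20 NOT discharged; K3⁷ NOT closed; counts unmoved (typed 28∕28 · discharged 5∕27); no count claim.  One finite `𝕋⁴_{L^K}` programme at fixed `ε = L^{−K}`, Bałaban AS
PRINTED; the YM mass gap (Clay) is NOT proved by any of this — R4 closes the conditional finite-𝕋⁴ rung `BalabanLadder.UV` only; NOT ℝ⁴, NOT OS.  No `def`, no `instance`, no
`notation`, no `sorry`.  Sources (location only): [III] (1.1) p.244, p.246, (2.18) p.257; [LF-II] (1.79)–(1.80) pp.383–384; [King1986] (3.10)–(3.11) p.656.
-/

noncomputable section

open Finset Real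
open _root_.Filter _root_.Topology

namespace Summit.QuantumFields.YangMills.BalabanUVNodes.N20FirstLevelSaturationToy

open Literature.MathematicalPhysics.QuantumFieldTheory.Balaban1983to89
open Literature.MathematicalPhysics.QuantumFieldTheory.Balaban1983to89.T4WeightBudget (RelWeightBound)
open Literature.MathematicalPhysics.QuantumFieldTheory.Balaban1983to89.T4BadClassBooking
open Literature.MathematicalPhysics.QuantumFieldTheory.Balaban1983to89.T4BadClassBooking.Sanity (sum_T sum_Bad_eq_mul_sum_T relWeightBound_of_summable)
open Summit.QuantumFields.YangMills.BalabanUVNodes.N19AgeScaleTransportBudget (eventually_lt_balabanActivity balabanActivity_pos summable_succ_pow_mul_balabanActivity)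

/-! ## §1  Entropy against activity: `(1 − a_K)^{N_K} → 0` when `N_K a_K → ∞`, and `m^K · a_K → ∞` for Bałaban's activity -/

section Arith

/-- If `N_K · a_K → +∞` with `a_K ≤ 1` then `(1 − a_K)^{N_K} → 0` (the probability that NONE of `N_K` independent blocks carries the event): squeeze under
`(1 − a)^N ≤ e^{−N·a}` (from `1 − a ≤ e^{−a}`; the tree has this inequality as `Literature.Algebra.EuclideanLattices.MRLemma510.one_sub_pow_le_exp_neg` — used inline here,
not imported, to keep this file's import closure inside the Bałaban ∕ YM libraries). [folklore] -/
theorem tendsto_one_sub_pow_zero {a : ℕ → ℝ} {N : ℕ → ℕ} (ha1 : ∀ K, a K ≤ 1)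
    (h : Tendsto (fun K => (N K : ℝ) * a K) atTop atTop) : Tendsto (fun K => (1 - a K) ^ N K) atTop (𝓝 0) := by
  have hexp : Tendsto (fun K => Real.exp (-((N K : ℝ) * a K))) atTop (𝓝 0) := Real.tendsto_exp_atBot.comp (tendsto_neg_atTop_atBot.comp h)
  refine tendsto_of_tendsto_of_tendsto_of_le_of_le tendsto_const_nhds hexp (fun K => pow_nonneg (sub_nonneg.2 (ha1 K)) _) fun K => ?_
  have hle := pow_le_pow_left₀ (sub_nonneg.2 (ha1 K)) (Real.one_sub_le_exp_neg (a K)) (N K)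
  rwa [← Real.exp_nat_mul, mul_neg] at hle

variable {A x₀ b : ℝ} {p₀ : ℕ}

/-- ★ **ENTROPY BEATS THE POLY-LOG ACTIVITY**: for `2 ≤ m`, `m^K · exp(−(A·log(x₀ + b·K))^{2p₀}) → +∞` — dag-n19-w1's `eventually_lt_balabanActivity` (the card's NotGeometric) at the
ratio `θ = 1∕m`: the activity eventually exceeds `M·m^{−K}` for every `M`. [folklore] -/
theorem tendsto_pow_mul_ageActivity_atTop (hA : 0 < A) (hx₀ : 1 < x₀) (hb : 0 < b) (p₀ : ℕ) {m : ℕ} (hm : 2 ≤ m) :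
    Tendsto (fun K : ℕ => (m : ℝ) ^ K * Real.exp (-((A * Real.log (x₀ + b * K)) ^ (2 * p₀)))) atTop atTop := by
  have hm0 : (0 : ℝ) < m := by exact_mod_cast (zero_lt_two.trans_le hm)
  have hθ : (0 : ℝ) < (m : ℝ)⁻¹ := inv_pos.2 hm0
  have hθ1 : (m : ℝ)⁻¹ < 1 := inv_lt_one_of_one_lt₀ (by exact_mod_cast (one_lt_two.trans_le hm))
  refine tendsto_atTop_atTop.2 fun M => ?_
  obtain ⟨N, hN⟩ := eventually_lt_balabanActivity hA hx₀ hb p₀ hθ hθ1 M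
  refine ⟨N, fun K hK => ?_⟩
  have h := hN K hK
  have hmK : (0 : ℝ) < (m : ℝ) ^ K := pow_pos hm0 K
  rw [inv_pow, ← div_eq_mul_inv, div_lt_iff₀ hmK] at h
  linarith [mul_comm (Real.exp (-((A * Real.log (x₀ + b * K)) ^ (2 * p₀)))) ((m : ℝ) ^ K)]

end Arith

/-! ## §2  In `T4BadClassBooking`'s product model: eventual probability `≥ c` ⇒ saturated ⇒ no relative weight bound -/

section Toy

/-- **EVENTUAL PROBABILITY `≥ c` SATURATES THE YOUNG CLASS** of the product model (`Σ_T A = 1`, `Σ_Bad A = q K` exactly; witness `t = 0`, any `l₀ ≥ 0`). [folklore] -/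
theorem saturated_toy_of_eventually_le {l₀ c : ℝ} {q : ℕ → ℝ} (hl₀ : 0 ≤ l₀) (h : ∀ᶠ K in atTop, c ≤ q K) : Saturated l₀ Sanity.T (Sanity.A q) Sanity.Bad c := by
  refine Eventually.frequently (h.mono fun K hK => ⟨0, by simpa using hl₀, ?_, ?_⟩)
  · rw [sum_T]; exact one_pos
  · rw [sum_Bad_eq_mul_sum_T, sum_T]; simpa using hK

/-- ★ **PROBABILITY TENDING TO ONE SATURATES AT EVERY LEVEL `c < 1`.** [folklore] -/
theorem saturated_toy_of_tendsto_one {l₀ c : ℝ} {q : ℕ → ℝ} (hl₀ : 0 ≤ l₀) (hc : c < 1) (h : Tendsto q atTop (𝓝 1)) :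
    Saturated l₀ Sanity.T (Sanity.A q) Sanity.Bad c :=
  saturated_toy_of_eventually_le hl₀ ((h.eventually (eventually_ge_nhds hc)).mono fun _ hK => hK)

/-- **… HENCE NO RELATIVE WEIGHT BOUND** for the young class — for NO weight sequence `W` and WHATEVER the second-run family `B` (`T4BadClassBooking.not_relWeightBound_of_saturated`
BY NAME at `c = 1∕2`). [folklore] -/
theorem not_relWeightBound_toy_of_tendsto_one {l₀ : ℝ} {q : ℕ → ℝ} (hl₀ : 0 ≤ l₀) (h : Tendsto q atTop (𝓝 1)) (B : ℕ → ℝ → Finset ℕ → ℝ) (W : ℕ → ℝ) :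
    ¬ RelWeightBound l₀ Sanity.T (Sanity.A q) B Sanity.Bad W :=
  not_relWeightBound_of_saturated one_half_pos (saturated_toy_of_tendsto_one hl₀ one_half_lt_one h) W

/-- **GENERAL BLOCK COUNTS**: `N_K` independent blocks at per-block probability `a_K ≤ 1` with `N_K·a_K → ∞` make the event certain, `1 − (1 − a_K)^{N_K} → 1` … [folklore] -/
theorem tendsto_blockEventProb_one_of_blocks {a : ℕ → ℝ} {N : ℕ → ℕ} (ha1 : ∀ K, a K ≤ 1) (h : Tendsto (fun K => (N K : ℝ) * a K) atTop atTop) :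
    Tendsto (fun K => 1 - (1 - a K) ^ N K) atTop (𝓝 1) := by
  simpa using tendsto_const_nhds.sub (tendsto_one_sub_pow_zero ha1 h)

/-- … so the young class at probability `1 − (1 − a_K)^{N_K}` admits NO relative weight bound (any `W`, any second run): VOLUME × ACTIVITY → ∞ is the whole mechanism. [folklore] -/
theorem not_relWeightBound_toy_of_blocks {l₀ : ℝ} {a : ℕ → ℝ} {N : ℕ → ℕ} (hl₀ : 0 ≤ l₀) (ha1 : ∀ K, a K ≤ 1)
    (h : Tendsto (fun K => (N K : ℝ) * a K) atTop atTop) (B : ℕ → ℝ → Finset ℕ → ℝ) (W : ℕ → ℝ) :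
    ¬ RelWeightBound l₀ Sanity.T (Sanity.A fun K => 1 - (1 - a K) ^ N K) B Sanity.Bad W :=
  not_relWeightBound_toy_of_tendsto_one hl₀ (tendsto_blockEventProb_one_of_blocks ha1 h) B W

end Toy

/-! ## §3  The Bałaban-letters instance: `m^K` finest blocks at the age-`K` activity -/

section FirstLevel

variable {A x₀ b : ℝ} {p₀ m : ℕ}

/-- the first-level event probability `1 − (1 − a K)^{m^K}` is non-negative (activity `≤ 1`). [folklore] -/
theorem blockEventProb_nonneg (A x₀ b : ℝ) (p₀ m K : ℕ) :
    0 ≤ 1 - (1 - Real.exp (-((A * Real.log (x₀ + b * K)) ^ (2 * p₀)))) ^ m ^ K := by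
  have h1 : Real.exp (-((A * Real.log (x₀ + b * K)) ^ (2 * p₀))) ≤ 1 := by
    rw [Real.exp_le_one_iff, neg_nonpos, pow_mul]; positivity
  exact sub_nonneg.2 (pow_le_one₀ (sub_nonneg.2 h1) (sub_le_self _ (Real.exp_pos _).le))

/-- … and at most one (activity `≥ 0`). [folklore] -/
theorem blockEventProb_le_one (A x₀ b : ℝ) (p₀ m K : ℕ) :
    1 - (1 - Real.exp (-((A * Real.log (x₀ + b * K)) ^ (2 * p₀)))) ^ m ^ K ≤ 1 := by
  have h1 : Real.exp (-((A * Real.log (x₀ + b * K)) ^ (2 * p₀))) ≤ 1 := by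
    rw [Real.exp_le_one_iff, neg_nonpos, pow_mul]; positivity
  exact sub_le_self _ (pow_nonneg (sub_nonneg.2 h1) _)

/-- ★★ **THE FIRST-LEVEL LARGE-FIELD EVENT BECOMES CERTAIN**: with `m^K` independent finest blocks (`2 ≤ m`), each large-field with probability Bałaban's age-`K` activity,
`1 − (1 − a K)^{m^K} → 1` (`m^K·a K → ∞` by §1, then `(1 − a K)^{m^K} ≤ exp(−m^K a K) → 0`). [folklore] -/
theorem tendsto_blockEventProb_one (hA : 0 < A) (hx₀ : 1 < x₀) (hb : 0 < b) (p₀ : ℕ) (hm : 2 ≤ m) :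
    Tendsto (fun K : ℕ => 1 - (1 - Real.exp (-((A * Real.log (x₀ + b * K)) ^ (2 * p₀)))) ^ m ^ K) atTop (𝓝 1) := by
  have h1 : ∀ K : ℕ, Real.exp (-((A * Real.log (x₀ + b * K)) ^ (2 * p₀))) ≤ 1 := fun K => by
    rw [Real.exp_le_one_iff, neg_nonpos, pow_mul]; positivity
  exact tendsto_blockEventProb_one_of_blocks (N := fun K => m ^ K) h1
    (by simpa only [Nat.cast_pow] using tendsto_pow_mul_ageActivity_atTop hA hx₀ hb p₀ hm)

/-- ★★ **THE FIRST-LEVEL CLASS IS SATURATED AT EVERY LEVEL `c < 1`** in the product model at Bałaban's letters (any `l₀ ≥ 0`). [folklore] -/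
theorem saturated_firstLevel_toy_ageActivity {l₀ c : ℝ} (hl₀ : 0 ≤ l₀) (hc : c < 1) (hA : 0 < A) (hx₀ : 1 < x₀) (hb : 0 < b) (p₀ : ℕ) (hm : 2 ≤ m) :
    Saturated l₀ Sanity.T (Sanity.A fun K => 1 - (1 - Real.exp (-((A * Real.log (x₀ + b * K)) ^ (2 * p₀)))) ^ m ^ K) Sanity.Bad c :=
  saturated_toy_of_tendsto_one hl₀ hc (tendsto_blockEventProb_one hA hx₀ hb p₀ hm)

/-- ★★ **… AND ADMITS NO RELATIVE WEIGHT BOUND** — for NO `W` and WHATEVER the second run: the kernel form, in the independent-block model, of «entropy `L^{4K}` beats the poly-log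
activity `e^{−C p₀(g₁)²}`, so the youngest large-field class cannot be booked by weight» (dag-n20-w3 LOCATED-1 (2); rows 9∕36 of the card's N20 census).  For Bałaban's dressed
measure this stays a COUNT (the policy wall's displayed antecedent). [folklore] -/
theorem not_relWeightBound_firstLevel_toy_ageActivity {l₀ : ℝ} (hl₀ : 0 ≤ l₀) (hA : 0 < A) (hx₀ : 1 < x₀) (hb : 0 < b) (p₀ : ℕ) (hm : 2 ≤ m)
    (B : ℕ → ℝ → Finset ℕ → ℝ) (W : ℕ → ℝ) :
    ¬ RelWeightBound l₀ Sanity.T (Sanity.A fun K => 1 - (1 - Real.exp (-((A * Real.log (x₀ + b * K)) ^ (2 * p₀)))) ^ m ^ K) B Sanity.Bad W :=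
  not_relWeightBound_toy_of_tendsto_one hl₀ (tendsto_blockEventProb_one hA hx₀ hb p₀ hm) B W

/-- **THE CONTRAST — THE VOLUME FACTOR, NOT THE ACTIVITY, IS THE WALL**: with ONE block per level (`m = 1`: per-level probability = the bare activity, which is `< 1` and SUMMABLE by
dag-n19-w1's `summable_succ_pow_mul_balabanActivity` at moment `0`) the same young class IS booked, `W = a` (`T4BadClassBooking.Sanity.relWeightBound_of_summable` BY NAME; `1 ≤ p₀`).
[folklore] -/
theorem relWeightBound_toy_ageActivity_oneBlock {l₀ : ℝ} (hA : 0 < A) (hx₀ : 1 < x₀) (hb : 0 < b) (hp₀ : 1 ≤ p₀) :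
    RelWeightBound l₀ Sanity.T (Sanity.A fun K => Real.exp (-((A * Real.log (x₀ + b * K)) ^ (2 * p₀))))
      (Sanity.A fun K => Real.exp (-((A * Real.log (x₀ + b * K)) ^ (2 * p₀)))) Sanity.Bad fun K => Real.exp (-((A * Real.log (x₀ + b * K)) ^ (2 * p₀))) := by
  refine relWeightBound_of_summable (fun K => (Real.exp_pos _).le) (fun K => ?_) ?_
  · have hlog : 0 < Real.log (x₀ + b * K) := Real.log_pos (by nlinarith [Nat.cast_nonneg (α := ℝ) K])
    have h := Real.exp_lt_exp.mpr (neg_lt_zero.2 (pow_pos (mul_pos hA hlog) (2 * p₀)))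
    rwa [Real.exp_zero] at h
  · simpa using summable_succ_pow_mul_balabanActivity hA hx₀ hb hp₀ 0

end FirstLevel

end Summit.QuantumFields.YangMills.BalabanUVNodes.N20FirstLevelSaturationToy
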